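import Literature.Probability.Percolation.KozmaNitzanHGluing
import HarnessLib
import HarnessLib.Audit.Tags

/-!
# QUANT lane, statements only (R0.e / R2.a): Kozma–Nitzan's Lemma 10 with the tolerance `δ` and the radius `R`
# as ARGUMENTS (`TargetPropertyAt`), and the effective Lemma 10 obligation `KNLemma10EffectiveAt`

builds on p205010 (kernel theorem, internal audit signed; external expert review pending)

Cell `prim-quant` (post-continuity programme, LANE 1), typer seat `prim-quant-stmt`; rungs R0.e and R2.a of
`run/shared/lean/prim/quant/LADDER.md`.  Nothing is proved here beyond one `Iff.rfl`.  Source of every name: the tree's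
formalisation of Kozma–Nitzan §4 (`Literature/Probability/Percolation/KozmaNitzanTargetLemma.lean`, `…HGluing.lean`):
`KozmaNitzan.TargetProperty d p` (HGluing.lean, "∀ ε ∃ δ ∀ H hittable ∃ R …"), `IsTarget`, `IsSubbox`, `FinSupp`, `Geom`,
`linkIn`, `LData.Ncont`, `seedBound` (KozmaNitzanBoxes.lean), `linkEvent`/`orthantFace` (GMFiniteSize.lean, Lemma 9's event),
`uniqZone` (UniquenessZone.lean, Lemma 7's event).

* `Quant.TargetPropertyAt d p ε δ H R` (R0.e) — the matrix of `TargetProperty` with `ε, δ, H, R` free: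
  for every finitely supported weighting `W` with a lattice subbox `D ⊇ B⟨R⟩` at `p`, every nonempty target `T ⊆ D`
  w.r.t. `(B = Icc lo hi, D, R, H)` and every source `o ∉ D`: `P_W(o ↔ B) > 1 - δ ⟹ P_W(o ↔ T) > 1 - ε`.
  `targetProperty_iff_targetPropertyAt : TargetProperty d p ↔ ∀ ε > 0, ∃ δ > 0, ∀ H hittable, ∃ R, TargetPropertyAt d p ε δ H R`
  holds by `Iff.rfl` (so the tree's Lemma 10 `targetProperty_of_conjecture3` is an instance producer with `∃ δ ∃ R`).
* `Quant.lemma10Delta ε := ε · min(ε/4, 1) / 12` — the tree's Step-I tolerance `δ = ε·min(δ₃(ε/2),1)/12`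
  (TargetLemma.lean, proof of `targetLemma_avoiding`, Step I) with Conjecture 3's `δ₃(ε') = ε'/2` supplied by
  `AdditiveGluing` (`additiveGluingSuffices_proof`, δ = ε/2); equals `ε²/48` for `ε ≤ 4` (QUANT.md §1 L6, §3).
* `Quant.lemma10Radius d p δ M ℓH k := 3M + ℓH + ⌈(1-p)^{-2d·N}/δ⌉₊ + 4`, `N = LData.Ncont d M k` — the tree's
  `R = j₁ + M + ℓmax + 2`, `j₁ = j₀ + Lcount - 1`, `j₀ = 2M + 2`, `Lcount = ⌈(1-p)^{-2dN}/δ⌉₊ + 1` (Steps II–III), with the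
  limit-produced scales `M = max n₁ n₂`, `ℓmax`, `k` now ARGUMENTS.
* `Quant.KNLemma10EffectiveAt d p` (R2.a, `@[conjecture]`, the obligation the R2 prover discharges by re-running the tree proof
  of `targetLemma_avoiding` with hypotheses in place of the three limit lemmas): for `0 < p < 1`, every `ε > 0`, every finite
  family `H` of geometries and all scales `m < M`, `ℓH`, `k` such that AT PARAMETER `p`
  (F1) Lemma 9's conclusion holds at `(m, M)` with tolerance `δ²`: `P_p(Λ_m ↔ every face orthant of Λ_M in Λ_M) > 1 - δ²`;
  (F2) Lemma 7's conclusion holds at `(m, M)`: `P_p(uniqZone m M) > 1 - δ²`;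
  (F3) every `g ∈ H` is hit from `Λ_m` at every scale `ℓ ≥ ℓH` with probability `> 1 - δ²`;
  (F4) `(1 - p^{seedBound d M})^k < δ` (enough seeds),
  where `δ = lemma10Delta ε`, the conclusion `TargetPropertyAt d p ε δ H (lemma10Radius d p δ M ℓH k)` holds.
  No `IsHittable`, no `θ(p) > 0`, no limit: the only non-arithmetic hypotheses are four finite-volume inequalities at `p`
  (exactly the facts `hface`, `huniq`, `hklspec`, `hk` the tree proof obtains from Lemmas 9, 7, the hittability thresholds and
  `exists_pow_lt_of_lt_one`, read at the single scales where it uses them).  Honest scope (QUANT.md §3–§4): discharging it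
  makes Lemma 10 effective GIVEN the scales; it produces no rate by itself — at `p = p_c` the inputs (F1)–(F3) are not known at
  any scale, and the §4 scheme stacks these tolerances into a tower (QUANT.md §3).

Design: predicates carry all data as explicit arguments (so partial effectivisations — e.g. with a different `δ(ε)` — are new
named instances, and a refuted shape is `¬ TargetPropertyAt …`); `0 < p < 1` inside the obligation (vacuous outside, as in the
tree lemma); no dimension hypothesis in the statement (the tree lemma assumes `[NeZero d]` in its proof).
-/

noncomputable section

namespace Summit.CriticalPhenomena.PercolationContinuityZ3.Theorems.Quant

open Literature.Probability.LatticeModels Literature.Probability.Percolation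
open Literature.Probability.Percolation.KozmaNitzan

/-- **(R0.e) Kozma–Nitzan's target property with `ε, δ, H, R` as arguments** (the quantifier-free matrix of the tree's
`KozmaNitzan.TargetProperty d p`, i.e. the conclusion of KN Lemma 10 at fixed tolerance and radius): for every finitely
supported weighting `W` of `ℤ^d` (support `Sfin`) carrying a lattice subbox `D` at parameter `p` with
`B⟨R⟩ = Icc (lo - R) (hi + R) ⊆ D`, every nonempty target `T ⊆ D` with respect to `(Icc lo hi, D, R, H)` and every source
`o ∈ Sfin \ D`:  `1 - δ < P_W(o ↔ Icc lo hi)` implies `1 - ε < P_W(o ↔ T)`.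
builds on p205010 (kernel theorem, internal audit signed; external expert review pending).
[cite: KozmaNitzan2024, §4 Lemma 10 (p. 17) and p. 16 (targets, hittable geometries)] -/
def TargetPropertyAt (d : ℕ) (p : unitInterval) (ε δ : ℝ) (H : List (Geom d)) (R : ℕ) : Prop :=
  ∀ (W : Sym2 (Site d) → unitInterval) (Sfin D : Finset (Site d)) (lo hi : Site d)
    (T : Finset (Site d)) (o : Site d),
    FinSupp W Sfin → IsSubbox W p D → D ⊆ Sfin → o ∈ Sfin → o ∉ D →
    Finset.Icc (lo - (R : Site d)) (hi + (R : Site d)) ⊆ D →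
    IsTarget T lo hi D R H → T ⊆ D → T.Nonempty →
    1 - δ < (prodBernoulli W).real (⋃ b ∈ Finset.Icc lo hi, openConn o b) →
      1 - ε < (prodBernoulli W).real (⋃ t ∈ T, openConn o t)

/-- The tree's `TargetProperty d p` is literally `∀ ε > 0, ∃ δ > 0, ∀ H hittable, ∃ R, TargetPropertyAt d p ε δ H R`.
builds on p205010 (kernel theorem, internal audit signed; external expert review pending).
[cite: KozmaNitzan2024, §4 Lemma 10 (p. 17)] -/
theorem targetProperty_iff_targetPropertyAt (d : ℕ) (p : unitInterval) :
    TargetProperty d p ↔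
      ∀ ⦃ε : ℝ⦄, 0 < ε → ∃ δ : ℝ, 0 < δ ∧ ∀ H : List (Geom d), (∀ g ∈ H, IsHittable p g) →
        ∃ R : ℕ, TargetPropertyAt d p ε δ H R :=
  Iff.rfl

/-- **Lemma 10's explicit tolerance** `δ(ε) = ε · min(ε/4, 1) / 12` (the tree's Step I: `δ = ε · min(δ₃(ε/2), 1) / 12` with
Conjecture 3's `δ₃(ε') = ε'/2` from additive gluing); `= ε²/48` for `0 ≤ ε ≤ 4`.
builds on p205010 (kernel theorem, internal audit signed; external expert review pending).
[cite: KozmaNitzan2024, §4 proof of Lemma 10, Step I (p. 18)] -/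
def lemma10Delta (ε : ℝ) : ℝ :=
  ε * min (ε / 4) 1 / 12

/-- **Lemma 10's explicit radius** given the scales: `R = 3M + ℓH + ⌈(1/(1-p))^{2d·N} / δ⌉₊ + 4` with
`N = LData.Ncont d M k` contacts (the tree's `R = j₁ + M + ℓmax + 2`, `j₁ = 2M + 2 + ⌈(1-p)^{-2dN}/δ⌉₊`, Steps II–III of
the proof of Lemma 10), where `M` (Lemmas 7/9 scale), `ℓH` (hittability scale of the family `H`) and `k` (number of seeds)
are arguments instead of limit-produced witnesses.
builds on p205010 (kernel theorem, internal audit signed; external expert review pending).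
[cite: KozmaNitzan2024, §4 proof of Lemma 10, Steps II–III (pp. 18–20)] -/
def lemma10Radius (d : ℕ) (p : unitInterval) (δ : ℝ) (M ℓH k : ℕ) : ℕ :=
  3 * M + ℓH + ⌈(1 / (1 - (p : ℝ)) ^ (2 * d * LData.Ncont d M k)) / δ⌉₊ + 4

/-- **(R2.a) Effective Kozma–Nitzan Lemma 10 at `(d, p)`** — the obligation: for `0 < p < 1`, every `ε > 0`, every finite
family of geometries `H` and all scales `m < M`, `ℓH`, `k` such that, with `δ = lemma10Delta ε`, AT PARAMETER `p`
(F1) `∀ a τ, 1 - δ² < P_p(linkEvent Λ_m (orthantFace a τ M) M)` (Lemma 9's conclusion at `(m, M)`),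
(F2) `1 - δ² < P_p(uniqZone m M)` (Lemma 7's conclusion at `(m, M)`),
(F3) `∀ g ∈ H, ∀ ℓ ≥ ℓH, 1 - δ² < P_p(linkIn (ℓQ_g) Λ_m (ℓF_g))` (hittability of `H` from `Λ_m` at scales `≥ ℓH`),
(F4) `(1 - p^{seedBound d M})^k < δ` (seeds),
the target property holds with tolerance `δ` and the explicit radius `lemma10Radius d p δ M ℓH k`.  Expected proof: the
tree's `targetLemma_avoiding` (Steps I–V) verbatim with (F1)–(F4) replacing `exists_forall_lt_real_linked_orthantFace`,
`exists_forall_le_lt_real_uniqZone`, `IsHittable.hit` and `exists_pow_lt_of_lt_one`, and `AdditiveGluing` (p205010 cone)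
supplying Conjecture 3 with `δ₃(ε') = ε'/2`.  Gives no rate by itself (QUANT.md §3–§4).
builds on p205010 (kernel theorem, internal audit signed; external expert review pending).
[cite: KozmaNitzan2024, §4 Lemma 10 (pp. 17–22)] -/
@[conjecture] def KNLemma10EffectiveAt (d : ℕ) (p : unitInterval) : Prop :=
  0 < (p : ℝ) → (p : ℝ) < 1 →
  ∀ (ε : ℝ), 0 < ε → ∀ (H : List (Geom d)) (m M ℓH k : ℕ), m < M →
    (∀ (a : Fin d) (τ : Fin d → ℤˣ), 1 - lemma10Delta ε ^ 2 <
        (bondPercolation (zdGraph d) p).real (linkEvent (box d m) (orthantFace a τ M) M)) →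
    1 - lemma10Delta ε ^ 2 < (bondPercolation (zdGraph d) p).real (uniqZone m M) →
    (∀ g ∈ H, ∀ ℓ : ℕ, ℓH ≤ ℓ → 1 - lemma10Delta ε ^ 2 <
        (bondPercolation (zdGraph d) p).real (linkIn (↑(g.Qset ℓ 0)) (box d m) (g.Fset ℓ 0))) →
    (1 - (p : ℝ) ^ seedBound d M) ^ k < lemma10Delta ε →
      TargetPropertyAt d p ε (lemma10Delta ε) H (lemma10Radius d p (lemma10Delta ε) M ℓH k)

/-! ### Addendum (2026-08-20, requested by prover p2): Lemma 10 with ADDITIVE loss -/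

/-- **Additive target property with loss `η` at radius `R`** (`AdditiveTargetPropertyAt d p η H R`, OURS — the shape the tree's
ADDITIVE gluing delivers for KN Lemma 10, P2-EFFECTIVE-KN.md §1): same data and hypotheses as `TargetPropertyAt` WITHOUT the input
threshold, and the conclusion `P_W(o ↔ T) ≥ P_W(o ↔ B) - η` (constant `1` in front of the input defect; the ε–δ form follows:
`additiveTargetPropertyAt_targetPropertyAt`).  Prover p2's `targetLemma_additive` is to prove it with `η = 6δ` and
`R = lemma10Radius d p δ M ℓH k` under the scale-indexed hypotheses (F1)–(F4) of `KNLemma10EffectiveAt`.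
Memo-level programme; an explicit function tending to 0 and nothing more.
builds on p205010 (kernel theorem, internal audit signed; external expert review pending).
[cite: KozmaNitzan2024, §4 Lemma 10 (p. 17) (the ε–δ original)] -/
def AdditiveTargetPropertyAt (d : ℕ) (p : unitInterval) (η : ℝ) (H : List (Geom d)) (R : ℕ) : Prop :=
  ∀ (W : Sym2 (Site d) → unitInterval) (Sfin D : Finset (Site d)) (lo hi : Site d)
    (T : Finset (Site d)) (o : Site d),
    FinSupp W Sfin → IsSubbox W p D → D ⊆ Sfin → o ∈ Sfin → o ∉ D →
    Finset.Icc (lo - (R : Site d)) (hi + (R : Site d)) ⊆ D →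
    IsTarget T lo hi D R H → T ⊆ D → T.Nonempty →
      (prodBernoulli W).real (⋃ b ∈ Finset.Icc lo hi, openConn o b) - η ≤
        (prodBernoulli W).real (⋃ t ∈ T, openConn o t)

/-- Additive loss `η` gives the ε–δ target property with `ε = δ + η` for every input threshold `δ`:
`AdditiveTargetPropertyAt d p η H R → TargetPropertyAt d p (δ + η) δ H R`.
builds on p205010 (kernel theorem, internal audit signed; external expert review pending).
[cite: KozmaNitzan2024, §4 Lemma 10 (p. 17)] -/
theorem additiveTargetPropertyAt_targetPropertyAt {d : ℕ} {p : unitInterval} {η : ℝ} {H : List (Geom d)} {R : ℕ}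
    (h : AdditiveTargetPropertyAt d p η H R) (δ : ℝ) : TargetPropertyAt d p (δ + η) δ H R := by
  intro W Sfin D lo hi T o hfin hsub hDS ho hoD hBR htgt hTD hTne hreach
  have key := h W Sfin D lo hi T o hfin hsub hDS ho hoD hBR htgt hTD hTne
  linarith

end Summit.CriticalPhenomena.PercolationContinuityZ3.Theorems.Quant
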